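import Summits.Parity.GeneralizedHardyLittlewood.Theorems.PrimeLevelFamEdgeMomentsBeyondDiagonalDiagOrderAssembly
import Summits.Parity.GeneralizedHardyLittlewood.Theorems.PrimeLevelFamEdgeMomentsBeyondDiagonalDiagOrderZero
import HarnessLib

/-!
# Route `PrimeLevelFamEdge`, crux K_A `MomentsBeyondDiagonal` (stmt-Parity-20007), line «petersson_layers» v4, stub `stub_diag`:
# **the GRADED form of the general-`Q` assembly — `SubDiag` for all `Q` of degree `≤ N` from the per-order targets of
# order `≤ N`; the rung `N = 0` (every constant `Q`) is UNCONDITIONAL**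

`…DiagOrderAssembly` / `…DiagOrderPos` reduce the registered stub `stub_diag : SubDiag` (∀ even-or-odd `Q`) to one `Q`-free
asymptotic per order `(i,j) ≠ (0,0)`, `i+j` even. Since a polynomial `Q` of degree `≤ N` only sees the orders `i, j ≤ N`, the
reduction is GRADED: the second-display shape of `diagPart q P Q Δ'` for every `Q` with `natDegree Q ≤ N` (even-or-odd or not)
follows from the targets with `i, j ≤ N` — a milestone ladder `N = 0, 1, 2, …` for the remaining analytic work (census R3(ii)).

* `diagPart_asymp_of_orderAsymptotics_le` — the graded assembly (`Δ ≤ 3/2`, `τ₀₀ = secondMomentForm Δ' P 1 / 2`);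
* `diagPart_asymp_of_natDegree_eq_zero` — **rung `N = 0`, unconditional: for every admissible `P`, every CONSTANT `Q` and
  `Δ' ∈ (1, 3/2]`, `‖diagPart q P Q Δ' − 2ζ(2)² q̂/(Δ'²ℓ²)·(Q₀² · secondMomentForm Δ' P 1)‖ ≤ C q̂ ℓ⁻³` for `q ≥ q₀`**
  (the `Q = 1` theorem `…DiagProfileOne.diagPart_profile_one_asymp` is the case `Q₀ = 1`).

Def-free; helper `--supports stmt-Parity-20007`; closes nothing (the stub needs every order); K_A, K_B and the Parity summit are
NOT proved; nothing about Landau–Siegel zeros.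

## References
* E. Kowalski, P. Michel, J. VanderKam, J. reine angew. Math. 526 (2000), (23)–(28) pp. 13–15, Prop. 5.1 (31) p. 18.
  [cite: KowalskiMichelVanderKam2000, (23)–(28) pp. 13–15 — derivation]
-/

noncomputable section

open scoped Real
open Complex MeasureTheory Polynomial
open Literature.NumberTheory.LFunctions

namespace Summit.Parity.GeneralizedHardyLittlewood.Theorems.MomentsBeyondDiagonal.DiagLines

open Summit.Parity.GeneralizedHardyLittlewood.Theorems.PrimeLevelFamEdgeIdeaDeltas.PeterssonLayers
  (diagPart HasShape SubOf SubDiag)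

/-- **THE GRADED GENERAL-`Q` ASSEMBLY.** Let `Δ ≤ 3/2`, `N : ℕ`, and `τ i j : ℝ → ℝ[X] → ℝ` level-free with
`τ₀₀(Δ',P) = secondMomentForm Δ' P 1 / 2`. If the per-order `Q`-free targets of `…DiagOrderAssembly` hold for all orders
`(i,j) ≠ (0,0)` with `i, j ≤ N` and `i+j` even, then for every admissible `P`, EVERY `Q` with `natDegree Q ≤ N` and every
`Δ' ∈ (1, Δ]` there are `C, q₀` with
`‖diagPart q P Q Δ' − 2ζ(2)² q̂/(Δ'²ℓ²) · Σ_{i,j ≤ deg Q} QᵢQⱼ(1+(−1)^{i+j}) τ_{ij}(Δ',P)‖ ≤ C q̂ ℓ⁻³` for all `q ≥ q₀`.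
[cite: KowalskiMichelVanderKam2000, (23)–(28) pp. 13–15 — derivation] -/
theorem diagPart_asymp_of_orderAsymptotics_le {Δ : ℝ} (hΔ : Δ ≤ 3 / 2) (N : ℕ) (τ : ℕ → ℕ → ℝ → ℝ[X] → ℝ)
    (h0 : ∀ (Δ' : ℝ) (P : ℝ[X]), τ 0 0 Δ' P = KMV2000.secondMomentForm Δ' P 1 / 2)
    (h : ∀ i j : ℕ, i ≤ N → j ≤ N → Even (i + j) → ¬(i = 0 ∧ j = 0) → ∀ P : ℝ[X], KMV2000.Admissible P →
      ∀ Δ' : ℝ, 1 < Δ' → Δ' ≤ Δ →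
      ∃ C : ℝ, ∃ q₀ : ℕ, ∀ (q : ℕ) [NeZero q], q₀ ≤ q →
        ‖(((Real.log (KMV2000.qhat q))⁻¹ : ℝ) : ℂ) ^ (i + j) * (KMV2000.qhat q : ℂ) *
          ∑ m₁ ∈ Finset.Icc 1 ⌊KMV2000.qhat q ^ Δ'⌋₊, ∑ m₂ ∈ Finset.Icc 1 ⌊KMV2000.qhat q ^ Δ'⌋₊,
            (KMV2000.mollifierCoeff P (KMV2000.qhat q ^ Δ') m₁ : ℂ) *
              (KMV2000.mollifierCoeff P (KMV2000.qhat q ^ Δ') m₂ : ℂ) *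
            ∑ d₁ ∈ m₁.divisors, ∑ d₂ ∈ m₂.divisors,
              (((((m₁ / d₁).gcd (m₂ / d₂) : ℝ) * ((m₁ : ℝ) * m₂) ^ (-(1 / 2 : ℝ)) *
                (∫ u₁ in Set.Ioi (0 : ℝ),
                  (Real.log (KMV2000.qhat q / ((d₁ * (m₂ / d₂ / (m₁ / d₁).gcd (m₂ / d₂)) : ℕ) : ℝ)) + Real.log u₁) ^ i *
                  ∫ u₂ in Set.Ioi (((((m₁ / (m₁ / d₁).gcd (m₂ / d₂)) * (m₂ / (m₁ / d₁).gcd (m₂ / d₂)) : ℕ) : ℝ) /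
                      KMV2000.qhat q ^ 2) / u₁),
                    Real.exp (-(u₁ + u₂)) / (1 - Real.exp (-(u₁ + u₂))) ^ 2 *
                    (Real.log (KMV2000.qhat q / ((d₂ * (m₁ / d₁ / (m₁ / d₁).gcd (m₂ / d₂)) : ℕ) : ℝ)) + Real.log u₂) ^ j)) : ℝ) : ℂ) -
          ((2 * riemannZeta 2 ^ 2 *
              ((KMV2000.qhat q / (Δ' ^ 2 * Real.log (KMV2000.qhat q) ^ 2) : ℝ) : ℂ)) * ((τ i j Δ' P : ℝ) : ℂ))‖ ≤
          C * KMV2000.qhat q * (Real.log (KMV2000.qhat q))⁻¹ ^ 3)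
    {P Q : ℝ[X]} (hP : KMV2000.Admissible P) (hQ : Q.natDegree ≤ N) {Δ' : ℝ} (h1 : 1 < Δ') (h2 : Δ' ≤ Δ) :
    ∃ C : ℝ, ∃ q₀ : ℕ, ∀ (q : ℕ) [NeZero q], q₀ ≤ q →
      ‖diagPart q P Q Δ' -
          ((2 * riemannZeta 2 ^ 2 *
              ((KMV2000.qhat q / (Δ' ^ 2 * Real.log (KMV2000.qhat q) ^ 2) : ℝ) : ℂ)) *
            (((∑ i ∈ Finset.range (Q.natDegree + 1), ∑ j ∈ Finset.range (Q.natDegree + 1),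
              Q.coeff i * Q.coeff j * (1 + (-1 : ℝ) ^ (i + j)) * τ i j Δ' P : ℝ)) : ℂ))‖ ≤
        C * KMV2000.qhat q * (Real.log (KMV2000.qhat q))⁻¹ ^ 3 := by
  obtain ⟨C₁, hC₁⟩ := norm_diagPart_sub_lineSeries_le_const P Q (by linarith) (h2.trans hΔ)
  -- per-order bounds for the full summands, guarded by `i, j ≤ N`
  have hterm : ∀ i j : ℕ, ∃ C : ℝ, ∃ q₀ : ℕ, ∀ (q : ℕ) [NeZero q], q₀ ≤ q → i ≤ N → j ≤ N →
      ‖(Q.coeff i : ℂ) * (Q.coeff j : ℂ) * (((Real.log (KMV2000.qhat q))⁻¹ : ℝ) : ℂ) ^ (i + j) *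
            (1 + (-1 : ℂ) ^ (i + j)) * (KMV2000.qhat q : ℂ) *
          ∑ m₁ ∈ Finset.Icc 1 ⌊KMV2000.qhat q ^ Δ'⌋₊, ∑ m₂ ∈ Finset.Icc 1 ⌊KMV2000.qhat q ^ Δ'⌋₊,
            (KMV2000.mollifierCoeff P (KMV2000.qhat q ^ Δ') m₁ : ℂ) *
              (KMV2000.mollifierCoeff P (KMV2000.qhat q ^ Δ') m₂ : ℂ) *
            ∑ d₁ ∈ m₁.divisors, ∑ d₂ ∈ m₂.divisors,
              (((((m₁ / d₁).gcd (m₂ / d₂) : ℝ) * ((m₁ : ℝ) * m₂) ^ (-(1 / 2 : ℝ)) *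
                (∫ u₁ in Set.Ioi (0 : ℝ),
                  (Real.log (KMV2000.qhat q / ((d₁ * (m₂ / d₂ / (m₁ / d₁).gcd (m₂ / d₂)) : ℕ) : ℝ)) + Real.log u₁) ^ i *
                  ∫ u₂ in Set.Ioi (((((m₁ / (m₁ / d₁).gcd (m₂ / d₂)) * (m₂ / (m₁ / d₁).gcd (m₂ / d₂)) : ℕ) : ℝ) /
                      KMV2000.qhat q ^ 2) / u₁),
                    Real.exp (-(u₁ + u₂)) / (1 - Real.exp (-(u₁ + u₂))) ^ 2 *
                    (Real.log (KMV2000.qhat q / ((d₂ * (m₁ / d₁ / (m₁ / d₁).gcd (m₂ / d₂)) : ℕ) : ℝ)) + Real.log u₂) ^ j)) : ℝ) : ℂ) -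
          ((2 * riemannZeta 2 ^ 2 *
              ((KMV2000.qhat q / (Δ' ^ 2 * Real.log (KMV2000.qhat q) ^ 2) : ℝ) : ℂ)) *
            ((Q.coeff i : ℂ) * (Q.coeff j : ℂ) * (1 + (-1 : ℂ) ^ (i + j)) * ((τ i j Δ' P : ℝ) : ℂ)))‖ ≤
        C * KMV2000.qhat q * (Real.log (KMV2000.qhat q))⁻¹ ^ 3 := by
    intro i j
    by_cases hN : i ≤ N ∧ j ≤ N
    · obtain ⟨C, q₀, hC⟩ := order_term_asymp (Q.coeff i) (Q.coeff j) (τ i j Δ' P) Δ' (i + j)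
        (fun q _ ↦ ∑ m₁ ∈ Finset.Icc 1 ⌊KMV2000.qhat q ^ Δ'⌋₊, ∑ m₂ ∈ Finset.Icc 1 ⌊KMV2000.qhat q ^ Δ'⌋₊,
            (KMV2000.mollifierCoeff P (KMV2000.qhat q ^ Δ') m₁ : ℂ) *
              (KMV2000.mollifierCoeff P (KMV2000.qhat q ^ Δ') m₂ : ℂ) *
            ∑ d₁ ∈ m₁.divisors, ∑ d₂ ∈ m₂.divisors,
              (((((m₁ / d₁).gcd (m₂ / d₂) : ℝ) * ((m₁ : ℝ) * m₂) ^ (-(1 / 2 : ℝ)) *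
                (∫ u₁ in Set.Ioi (0 : ℝ),
                  (Real.log (KMV2000.qhat q / ((d₁ * (m₂ / d₂ / (m₁ / d₁).gcd (m₂ / d₂)) : ℕ) : ℝ)) + Real.log u₁) ^ i *
                  ∫ u₂ in Set.Ioi (((((m₁ / (m₁ / d₁).gcd (m₂ / d₂)) * (m₂ / (m₁ / d₁).gcd (m₂ / d₂)) : ℕ) : ℝ) /
                      KMV2000.qhat q ^ 2) / u₁),
                    Real.exp (-(u₁ + u₂)) / (1 - Real.exp (-(u₁ + u₂))) ^ 2 *
                    (Real.log (KMV2000.qhat q / ((d₂ * (m₁ / d₁ / (m₁ / d₁).gcd (m₂ / d₂)) : ℕ) : ℝ)) + Real.log u₂) ^ j)) : ℝ) : ℂ))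
        (by
          intro hij
          by_cases h00 : i = 0 ∧ j = 0
          · obtain ⟨rfl, rfl⟩ := h00
            rw [h0 Δ' P]
            exact lineSeries_order_zero_asymp hP h1 (h2.trans hΔ)
          · exact h i j hN.1 hN.2 hij h00 P hP Δ' h1 h2)
      exact ⟨C, q₀, fun q _ hq _ _ ↦ hC q hq⟩
    · exact ⟨0, 0, fun q _ _ hi hj ↦ (hN ⟨hi, hj⟩).elim⟩
  choose C q₀ hC using hterm
  refine ⟨27 * max C₁ 0 + ∑ i ∈ Finset.range (Q.natDegree + 1), ∑ j ∈ Finset.range (Q.natDegree + 1), C i j,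
    max ((Finset.range (Q.natDegree + 1) ×ˢ Finset.range (Q.natDegree + 1)).sup (fun p ↦ q₀ p.1 p.2)) 400,
    fun q _ hq ↦ ?_⟩
  have hq400 : 400 ≤ q := (le_max_right _ _).trans hq
  have hqsup : (Finset.range (Q.natDegree + 1) ×ˢ Finset.range (Q.natDegree + 1)).sup (fun p ↦ q₀ p.1 p.2) ≤ q :=
    (le_max_left _ _).trans hq
  have hQ3 : 3 ≤ KMV2000.qhat q := FirstOrderAFE.three_le_qhat hq400
  have hQ1 : 1 ≤ KMV2000.qhat q := by linarith
  have hℓ0 : 0 < Real.log (KMV2000.qhat q) := Real.log_pos (by linarith)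
  -- the box tail: `C₁ ≤ 27 max(C₁,0) q̂ ℓ⁻³`
  have hunit : (1 : ℝ) ≤ 27 * KMV2000.qhat q * (Real.log (KMV2000.qhat q))⁻¹ ^ 3 := by
    have hl := log_pow_three_le_mul hQ1
    rw [inv_pow, ← div_eq_mul_inv, le_div_iff₀ (pow_pos hℓ0 3)]
    linarith
  have hC₁' : C₁ ≤ 27 * max C₁ 0 * (KMV2000.qhat q * (Real.log (KMV2000.qhat q))⁻¹ ^ 3) := by
    calc C₁ ≤ max C₁ 0 := le_max_left _ _
      _ = max C₁ 0 * 1 := (mul_one _).symm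
      _ ≤ max C₁ 0 * (27 * KMV2000.qhat q * (Real.log (KMV2000.qhat q))⁻¹ ^ 3) :=
          mul_le_mul_of_nonneg_left hunit (le_max_right _ _)
      _ = _ := by ring
  -- the main term as a double sum
  have hmain : ((2 * riemannZeta 2 ^ 2 *
        ((KMV2000.qhat q / (Δ' ^ 2 * Real.log (KMV2000.qhat q) ^ 2) : ℝ) : ℂ)) *
      (((∑ i ∈ Finset.range (Q.natDegree + 1), ∑ j ∈ Finset.range (Q.natDegree + 1),
        Q.coeff i * Q.coeff j * (1 + (-1 : ℝ) ^ (i + j)) * τ i j Δ' P : ℝ)) : ℂ)) =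
      ∑ i ∈ Finset.range (Q.natDegree + 1), ∑ j ∈ Finset.range (Q.natDegree + 1),
        ((2 * riemannZeta 2 ^ 2 *
          ((KMV2000.qhat q / (Δ' ^ 2 * Real.log (KMV2000.qhat q) ^ 2) : ℝ) : ℂ)) *
          ((Q.coeff i : ℂ) * (Q.coeff j : ℂ) * (1 + (-1 : ℂ) ^ (i + j)) * ((τ i j Δ' P : ℝ) : ℂ))) := by
    rw [Complex.ofReal_sum, Finset.mul_sum]
    refine Finset.sum_congr rfl fun i _ ↦ ?_
    rw [Complex.ofReal_sum, Finset.mul_sum]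
    refine Finset.sum_congr rfl fun j _ ↦ ?_
    push_cast
    ring
  refine (norm_sub_le_norm_sub_add_norm_sub _ _ _).trans ((add_le_add (hC₁ q hq400) ?_).trans
    (?_ : C₁ + (∑ i ∈ Finset.range (Q.natDegree + 1), ∑ j ∈ Finset.range (Q.natDegree + 1), C i j) *
        KMV2000.qhat q * (Real.log (KMV2000.qhat q))⁻¹ ^ 3 ≤ _))
  · rw [hmain]
    refine (norm_sum_sum_sub_sum_sum_le _ _ _ _).trans ?_
    calc _ ≤ ∑ i ∈ Finset.range (Q.natDegree + 1), ∑ j ∈ Finset.range (Q.natDegree + 1),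
            C i j * KMV2000.qhat q * (Real.log (KMV2000.qhat q))⁻¹ ^ 3 := by
          refine Finset.sum_le_sum fun i hi ↦ Finset.sum_le_sum fun j hj ↦ hC i j q ?_ ?_ ?_
          · have hle : q₀ i j ≤ (Finset.range (Q.natDegree + 1) ×ˢ Finset.range (Q.natDegree + 1)).sup
                (fun p ↦ q₀ p.1 p.2) :=
              Finset.le_sup (f := fun p : ℕ × ℕ ↦ q₀ p.1 p.2) (b := (i, j)) (Finset.mem_product.mpr ⟨hi, hj⟩)
            exact hle.trans hqsup
          · have := Finset.mem_range.mp hi; omega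
          · have := Finset.mem_range.mp hj; omega
      _ = (∑ i ∈ Finset.range (Q.natDegree + 1), ∑ j ∈ Finset.range (Q.natDegree + 1), C i j) *
            KMV2000.qhat q * (Real.log (KMV2000.qhat q))⁻¹ ^ 3 := by
          rw [Finset.sum_mul, Finset.sum_mul]
          refine Finset.sum_congr rfl fun i _ ↦ ?_
          rw [Finset.sum_mul, Finset.sum_mul]
  · calc C₁ + (∑ i ∈ Finset.range (Q.natDegree + 1), ∑ j ∈ Finset.range (Q.natDegree + 1), C i j) *
            KMV2000.qhat q * (Real.log (KMV2000.qhat q))⁻¹ ^ 3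
        ≤ 27 * max C₁ 0 * (KMV2000.qhat q * (Real.log (KMV2000.qhat q))⁻¹ ^ 3) +
            (∑ i ∈ Finset.range (Q.natDegree + 1), ∑ j ∈ Finset.range (Q.natDegree + 1), C i j) *
              KMV2000.qhat q * (Real.log (KMV2000.qhat q))⁻¹ ^ 3 := by linarith
      _ = (27 * max C₁ 0 + ∑ i ∈ Finset.range (Q.natDegree + 1), ∑ j ∈ Finset.range (Q.natDegree + 1), C i j) *
            KMV2000.qhat q * (Real.log (KMV2000.qhat q))⁻¹ ^ 3 := by ring

/-- **RUNG `N = 0` OF THE LADDER, UNCONDITIONAL: the diagonal part for EVERY CONSTANT `Q`.** For `KMV2000.Admissible P`,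
`Q` with `natDegree Q = 0` and `Δ' ∈ (1, 3/2]` there are `C, q₀` with, for all levels `q ≥ q₀`,
`‖diagPart q P Q Δ' − 2ζ(2)² q̂/(Δ'² log² q̂)·(Q₀² · secondMomentForm Δ' P 1)‖ ≤ C q̂ (log q̂)⁻³` (`Q₀ = Q.coeff 0`); the case
`Q = 1` is `…DiagProfileOne.diagPart_profile_one_asymp`.
[cite: KowalskiMichelVanderKam2000, Prop. 5.1 (31) p. 18 — derivation (constant Q, general admissible P)] -/
theorem diagPart_asymp_of_natDegree_eq_zero {P Q : ℝ[X]} (hP : KMV2000.Admissible P) (hQ : Q.natDegree = 0)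
    {Δ' : ℝ} (h1 : 1 < Δ') (h32 : Δ' ≤ 3 / 2) :
    ∃ C : ℝ, ∃ q₀ : ℕ, ∀ (q : ℕ) [NeZero q], q₀ ≤ q →
      ‖diagPart q P Q Δ' -
          ((2 * riemannZeta 2 ^ 2 *
              ((KMV2000.qhat q / (Δ' ^ 2 * Real.log (KMV2000.qhat q) ^ 2) : ℝ) : ℂ)) *
            ((Q.coeff 0 ^ 2 * KMV2000.secondMomentForm Δ' P 1 : ℝ) : ℂ))‖ ≤
        C * KMV2000.qhat q * (Real.log (KMV2000.qhat q))⁻¹ ^ 3 := by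
  obtain ⟨C, q₀, hC⟩ := diagPart_asymp_of_orderAsymptotics_le le_rfl 0
    (fun _ _ Δ' P ↦ KMV2000.secondMomentForm Δ' P 1 / 2) (fun _ _ ↦ rfl)
    (fun i j hi hj _ h00 ↦ (h00 ⟨Nat.le_zero.mp hi, Nat.le_zero.mp hj⟩).elim) hP hQ.le h1 h32
  refine ⟨C, q₀, fun q _ hq ↦ ?_⟩
  have key : (∑ i ∈ Finset.range (Q.natDegree + 1), ∑ j ∈ Finset.range (Q.natDegree + 1),
      Q.coeff i * Q.coeff j * (1 + (-1 : ℝ) ^ (i + j)) * (KMV2000.secondMomentForm Δ' P 1 / 2) : ℝ) =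
      Q.coeff 0 ^ 2 * KMV2000.secondMomentForm Δ' P 1 := by
    rw [hQ, zero_add, Finset.sum_range_one, Finset.sum_range_one]
    norm_num
    ring
  have h := hC q hq
  rw [key] at h
  exact h

end Summit.Parity.GeneralizedHardyLittlewood.Theorems.MomentsBeyondDiagonal.DiagLines

end
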